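import Literature.Barriers.AtomisticToContinuum.AnticontinuumLocalizationConfigChain
import Literature.Probability.LatticeModels.WeaklyCoupledChainDecay
import Mathlib.Analysis.Real.Pi.Bounds
import HarnessLib

/-!
# Discharge of `DeRoeckHuveneers2015_decorrelation_config`: decay of correlations for the configurational Gibbs measure of the rotor chain

`Literature/Barriers/AtomisticToContinuum/` — the named fact
`DeRoeckHuveneers2015_decorrelation_config` of `AnticontinuumLocalizationConfigGibbs.lean`
(eq. (7.1) of De Roeck–Huveneers 2015 for momentum-independent observables: exponential
decorrelation of the configurational Gibbs measure `ν_{N,β,γ}` of the rotor chain at small `β`,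
with Dirichlet-form right-hand side, uniformly in `N`) is PROVED here:
`DeRoeckHuveneers2015_decorrelation_config_holds`, with the explicit constants `C = 720`,
`c = (log 2)/2`, `β₁ = 1/(10(2γ+2))`.

The proof is not the semigroup/Witten-Laplacian argument of Helffer and Ledoux cited in the
source, but the elementary one-dimensional transfer-operator / martingale method developed in
`Literature/Probability/LatticeModels/WeaklyCoupledChain*.lean` for nearest-neighbour chains with
compact spins: the rotor weight `e^{-β∑_x V_x}` is the product of step factors pinched in
`[e^{-β(2γ+2)}, 1]` (`rotorSpec`, `AnticontinuumLocalizationConfigChain.lean`), so that for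
`β(2γ+2) ≤ 1/10` the contraction factor `θ = 2ρ₀⁴(ρ₀-1)²` of the increment recursion is
`≤ 1/2` (`weakCoupling_constants`); the uniform Poincaré inequality (`variance_le`) and the
geometric decay of the increment variances (`abs_cov_le_sqrt_var`) then give
`abs_integral_mul_configGibbs_le`, the oriented window form of (7.1); windows are converted to
coordinate-dependence sets by `dependsOn_lt/ge_of_dependsOnlyNearConfig`, and Gibbs averages to
chain expectations by `integral_configGibbs_eq_condExp`. No definitions.
-/

noncomputable section

open MeasureTheory Function Set Filter
open scoped ENNReal NNReal

namespace Literature.Barriers.AtomisticToContinuum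

namespace HeatConduction.RotorChain

open Literature.MathematicalPhysics.KineticTheory.HeatConduction
open Literature.Probability.LatticeModels Literature.Probability.LatticeModels.BoxChain

variable {N : ℕ}

/-! ### Windows as coordinate-dependence sets -/

/-- A window observable around `a` of radius `R` depends only on the first `⌊a + R⌋ + 1`
coordinates (`a + R ≥ 0`). [folklore] -/
theorem dependsOn_lt_of_dependsOnlyNearConfig {a : Fin N} {R : ℝ} {u : (Fin N → ℝ) → ℝ}
    (hu : DependsOnlyNearConfig N a R u) (haR : 0 ≤ (a.val : ℝ) + R) :
    DependsOn u {i : Fin N | i.val < ⌊(a.val : ℝ) + R⌋₊ + 1} := by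
  intro q q' h
  refine hu q q' fun x hx => h x ?_
  simp only [Set.mem_setOf_eq]
  have hx' : (x.val : ℝ) ≤ a.val + R := by linarith [(abs_le.mp hx).2]
  have : x.val ≤ ⌊(a.val : ℝ) + R⌋₊ := (Nat.le_floor_iff haR).2 hx'
  omega

/-- A window observable around `b` of radius `R` depends only on the coordinates
`≥ ⌈b - R⌉`. [folklore] -/
theorem dependsOn_ge_of_dependsOnlyNearConfig {b : Fin N} {R : ℝ} {v : (Fin N → ℝ) → ℝ}
    (hv : DependsOnlyNearConfig N b R v) :
    DependsOn v {i : Fin N | ⌈(b.val : ℝ) - R⌉₊ ≤ i.val} := by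
  intro q q' h
  refine hv q q' fun x hx => h x ?_
  simp only [Set.mem_setOf_eq]
  have hx' : (b.val : ℝ) - R ≤ x.val := by linarith [(abs_le.mp hx).1]
  exact Nat.ceil_le.2 hx'

/-- A window of negative reach (`a + R < 0`) sees no coordinate: the observable is constant. [folklore] -/
theorem eq_of_dependsOnlyNearConfig_of_neg {a : Fin N} {R : ℝ} {u : (Fin N → ℝ) → ℝ}
    (hu : DependsOnlyNearConfig N a R u) (haR : (a.val : ℝ) + R < 0) (q q' : Fin N → ℝ) : u q = u q' :=
  hu q q' fun x hx => by
    have h0 : (0 : ℝ) ≤ x.val := Nat.cast_nonneg _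
    have h1 : (0 : ℝ) ≤ a.val := Nat.cast_nonneg _
    have := (abs_le.mp hx).2
    have := abs_nonneg ((x.val : ℝ) - a.val)
    exfalso
    linarith

/-- The gap between a left window `[·, a + Ru]` and a right window `[b - Rv, ·]`, measured in
levels, dominates the real gap `(b - a) - Ru - Rv` (`a + Ru ≥ 0`). [folklore] -/
theorem gap_le_natGap {a b : Fin N} {Ru Rv : ℝ} (haR : 0 ≤ (a.val : ℝ) + Ru) :
    (b.val : ℝ) - a.val - Ru - Rv ≤
      (((⌈(b.val : ℝ) - Rv⌉₊ + 1 - (⌊(a.val : ℝ) + Ru⌋₊ + 1) : ℕ)) : ℝ) := by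
  set l : ℕ := ⌈(b.val : ℝ) - Rv⌉₊ with hl
  set m : ℕ := ⌊(a.val : ℝ) + Ru⌋₊ with hm
  have h1 : (b.val : ℝ) - Rv ≤ l := Nat.le_ceil _
  have h2 : (m : ℝ) ≤ a.val + Ru := Nat.floor_le haR
  have h3 : (l : ℝ) ≤ ((l - m : ℕ) : ℝ) + m := by exact_mod_cast (le_tsub_add : l ≤ l - m + m)
  rw [Nat.add_sub_add_right]
  linarith

/-! ### Numerical constants at weak coupling -/

/-- For `0 ≤ x ≤ 1/10`: `e^x ≤ 6/5`, the contraction factor `2e^{4x}(e^x - 1)² ≤ 1/2`, and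
`e^{6x} ≤ 3`. [folklore] -/
theorem weakCoupling_constants {x : ℝ} (hx0 : 0 ≤ x) (hx : x ≤ 1 / 10) :
    Real.exp x ≤ 6 / 5 ∧ 2 * (Real.exp x ^ 2 * (Real.exp x - 1)) ^ 2 ≤ 1 / 2 ∧ Real.exp x ^ 6 ≤ 3 := by
  set ρ := Real.exp x with hρ
  have hρ1 : 1 ≤ ρ := Real.one_le_exp hx0
  have hsub : ρ - 1 ≤ 2 * x := by
    have h := Real.abs_exp_sub_one_le (x := x) (by rw [abs_of_nonneg hx0]; linarith)
    rw [abs_of_nonneg hx0] at h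
    exact (le_abs_self _).trans h
  have hρle : ρ ≤ 6 / 5 := by linarith
  have hρ0 : 0 ≤ ρ := by linarith
  have h2 : ρ ^ 2 ≤ (6 / 5) ^ 2 := pow_le_pow_left₀ hρ0 hρle 2
  have h6 : ρ ^ 6 ≤ (6 / 5) ^ 6 := pow_le_pow_left₀ hρ0 hρle 6
  have hd : (ρ - 1) ^ 2 ≤ (1 / 5) ^ 2 := pow_le_pow_left₀ (by linarith) (by linarith) 2
  refine ⟨hρle, ?_, h6.trans (by norm_num)⟩
  have h4 : (ρ ^ 2 * (ρ - 1)) ^ 2 = (ρ ^ 2) ^ 2 * (ρ - 1) ^ 2 := by ring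
  rw [h4]
  have h22 : (ρ ^ 2) ^ 2 ≤ ((6 / 5 : ℝ) ^ 2) ^ 2 := pow_le_pow_left₀ (by positivity) h2 2
  calc 2 * ((ρ ^ 2) ^ 2 * (ρ - 1) ^ 2) ≤ 2 * ((((6 : ℝ) / 5) ^ 2) ^ 2 * (1 / 5) ^ 2) := by
        gcongr
    _ ≤ 1 / 2 := by norm_num

/-- `√(1/2) = e^{-(log 2)/2}`. [folklore] -/
theorem sqrt_half_eq_exp : Real.sqrt (1 / 2) = Real.exp (-(Real.log 2 / 2)) := by
  rw [Real.sqrt_eq_iff_mul_self_eq (by norm_num) (Real.exp_pos _).le, ← Real.exp_add,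
    show -(Real.log 2 / 2) + -(Real.log 2 / 2) = -Real.log 2 by ring, Real.exp_neg, Real.exp_log two_pos]
  norm_num

/-! ### The decorrelation inequality for the configurational Gibbs measure -/

/-- **Decay of correlations for the configurational Gibbs measure of the rotor chain,
oriented form.** For `0 < β`, `β(2γ+2) ≤ 1/10`, `γ ≥ 0`, smooth window observables `u`
(around `a`, radius `R_u`) and `v` (around `b`, radius `R_v`) of zero mean (useful for `a ≤ b`):
`|∫ uv dν| ≤ 720 e^{-(log 2/2)((b-a) - R_u - R_v)} (∑_x∫(∂_x u)²dν)^{1/2} (∑_x∫(∂_x v)²dν)^{1/2}`.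
Proof: the chain theory of `Literature/Probability/LatticeModels/WeaklyCoupledChain*.lean`
(uniform Poincaré inequality + exponential decay of the increment variances) for `rotorSpec`,
whose contraction factor is `≤ 1/2` in this regime. [cite: DeRoeckHuveneers2015, §7 eq. (7.1)] -/
theorem abs_integral_mul_configGibbs_le {β γ : ℝ} (hβ : 0 < β) (hβx : β * (2 * γ + 2) ≤ 1 / 10) (hγ : 0 ≤ γ)
    {u v : (Fin N → ℝ) → ℝ} {a b : Fin N} {Ru Rv : ℝ}
    (hus : ContDiff ℝ 1 u) (hvs : ContDiff ℝ 1 v)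
    (hu : DependsOnlyNearConfig N a Ru u) (hv : DependsOnlyNearConfig N b Rv v)
    (hu0 : ∫ q, u q ∂(configGibbs N β γ) = 0) (hv0 : ∫ q, v q ∂(configGibbs N β γ) = 0) :
    |∫ q, u q * v q ∂(configGibbs N β γ)| ≤
      720 * Real.exp (-(Real.log 2 / 2) * ((b.val : ℝ) - a.val - Ru - Rv)) *
        Real.sqrt (configGradSqNorm (configGibbs N β γ) u) *
        Real.sqrt (configGradSqNorm (configGibbs N β γ) v) := by
  set ν := configGibbs N β γ with hν
  set S := rotorSpec N hβ.le hγ with hS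
  -- constants
  have hx0 : 0 ≤ β * (2 * γ + 2) := by positivity
  obtain ⟨hρle, hθle, hρ6⟩ := weakCoupling_constants hx0 hβx
  have hratio : S.ratio = Real.exp (β * (2 * γ + 2)) := rotorSpec_ratio hβ.le hγ
  set θ : ℝ := 2 * (S.ratio ^ 2 * (S.ratio - 1)) ^ 2 with hθdef
  have hθhalf : θ ≤ 1 / 2 := by rw [hθdef, hratio]; exact hθle
  have hθ1 : θ < 1 := by linarith
  have hθ0 : 0 ≤ θ := by positivity
  have hL : S.L = 2 * Real.pi := rfl
  have hA : 2 * S.ratio ^ 6 * S.L ^ 2 ≤ 240 := by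
    rw [hL, hratio]
    have hπ : Real.pi ^ 2 ≤ 10 := by nlinarith [Real.pi_lt_d2, Real.pi_pos]
    have hπ4 : (2 * Real.pi) ^ 2 ≤ 40 := by nlinarith [hπ]
    calc 2 * Real.exp (β * (2 * γ + 2)) ^ 6 * (2 * Real.pi) ^ 2 ≤ 2 * 3 * 40 :=
          mul_le_mul (mul_le_mul_of_nonneg_left hρ6 (by norm_num)) hπ4 (sq_nonneg _) (by norm_num)
      _ = 240 := by norm_num
  -- the bridge `∫ h dν = E_0 h`
  have hbr : ∀ h : (Fin N → ℝ) → ℝ, ∫ q, h q ∂ν = S.condExp 0 h 0 := fun h =>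
    integral_configGibbs_eq_condExp hβ.le hγ h
  -- means vanish
  have hEu : ∀ p, S.condExp 0 u p = 0 := fun p => by rw [S.condExp_zero_apply u p, ← hbr u]; exact hu0
  have hEv : ∀ p, S.condExp 0 v p = 0 := fun p => by rw [S.condExp_zero_apply v p, ← hbr v]; exact hv0
  -- the right-hand side is nonnegative
  have hRHS0 : 0 ≤ 720 * Real.exp (-(Real.log 2 / 2) * ((b.val : ℝ) - a.val - Ru - Rv)) *
      Real.sqrt (configGradSqNorm ν u) * Real.sqrt (configGradSqNorm ν v) := by positivity
  -- degenerate window: `u` is constant, hence zero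
  by_cases haR : (a.val : ℝ) + Ru < 0
  · have hconst : ∀ q, u q = u 0 := fun q => eq_of_dependsOnlyNearConfig_of_neg hu haR q 0
    have hu00 : u 0 = 0 := by
      have h1 : ∫ q, u q ∂ν = u 0 := by
        rw [integral_congr_ae (ae_of_all _ fun q => hconst q), integral_const, smul_eq_mul]
        have hone := integral_configGibbs_one (N := N) hβ.le hγ
        rw [integral_const, smul_eq_mul, mul_one] at hone
        rw [hone, one_mul]
      rw [← h1]; exact hu0
    have hzero : ∫ q, u q * v q ∂ν = 0 := by
      rw [integral_congr_ae (ae_of_all _ fun q => show u q * v q = (0 : ℝ) by rw [hconst q, hu00, zero_mul]),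
        integral_zero]
    rw [hzero, abs_zero]
    exact hRHS0
  have haR' : 0 ≤ (a.val : ℝ) + Ru := not_lt.mp haR
  -- dependence sets
  set m : ℕ := ⌊(a.val : ℝ) + Ru⌋₊ + 1 with hm
  set l : ℕ := ⌈(b.val : ℝ) - Rv⌉₊ with hl
  have hfm : DependsOn u {i : Fin N | i.val < m} := dependsOn_lt_of_dependsOnlyNearConfig hu haR'
  have hgl : DependsOn v {i : Fin N | l ≤ i.val} := dependsOn_ge_of_dependsOnlyNearConfig hv
  -- `C¹` observables have continuous configurational partials `∂_k = partialConfig k`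
  -- (`BoxChain.hasPartials_deriv_of_contDiff`, `partialConfig` unfolds definitionally)
  have hPu : BoxChain.HasPartials u fun k => partialConfig k u := hasPartials_deriv_of_contDiff hus
  have hPv : BoxChain.HasPartials v fun k => partialConfig k v := hasPartials_deriv_of_contDiff hvs
  -- covariance = integral of the product (means vanish)
  have hcov : ∫ q, u q * v q ∂ν = S.condExp 0 (fun p => (u p - S.condExp 0 u p) * (v p - S.condExp 0 v p)) 0 := by
    rw [hbr]
    congr 1
    funext p
    rw [hEu p, hEv p, sub_zero, sub_zero]
  -- the chain bounds
  have hdecay := S.abs_cov_le_sqrt_var hθ1 hPu hPv hfm hgl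
  have hVu := S.variance_le hθ1 hPu
  have hVv := S.variance_le hθ1 hPv
  -- Dirichlet forms
  have hGu : ∑ k : Fin N, S.condExp 0 (fun p => partialConfig k u p ^ 2) 0 = configGradSqNorm ν u := by
    rw [configGradSqNorm_def]
    exact Finset.sum_congr rfl fun k _ => (hbr _).symm
  have hGv : ∑ k : Fin N, S.condExp 0 (fun p => partialConfig k v p ^ 2) 0 = configGradSqNorm ν v := by
    rw [configGradSqNorm_def]
    exact Finset.sum_congr rfl fun k _ => (hbr _).symm
  rw [hGu] at hVu
  rw [hGv] at hVv
  have hGu0 : 0 ≤ configGradSqNorm ν u := by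
    rw [← hGu]; exact Finset.sum_nonneg fun k _ => S.condExp_nonneg 0 (fun _ => sq_nonneg _) 0
  have hGv0 : 0 ≤ configGradSqNorm ν v := by
    rw [← hGv]; exact Finset.sum_nonneg fun k _ => S.condExp_nonneg 0 (fun _ => sq_nonneg _) 0
  -- numerical simplifications
  have hcoef : (2 * S.ratio ^ 6 * S.L ^ 2) / (1 - θ) ≤ 480 := by
    rw [div_le_iff₀ (by linarith)]
    linarith [hA]
  have hVu' : S.condExp 0 (fun p => (u p - S.condExp 0 u p) ^ 2) 0 ≤ 480 * configGradSqNorm ν u :=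
    hVu.trans (mul_le_mul_of_nonneg_right hcoef hGu0)
  have hVv' : S.condExp 0 (fun p => (v p - S.condExp 0 v p) ^ 2) 0 ≤ 480 * configGradSqNorm ν v :=
    hVv.trans (mul_le_mul_of_nonneg_right hcoef hGv0)
  have hsq1 : (Real.sqrt (1 - θ))⁻¹ ≤ 3 / 2 := by
    rw [inv_le_comm₀ (Real.sqrt_pos.2 (by linarith)) (by norm_num)]
    rw [Real.le_sqrt (by norm_num) (by linarith)]
    norm_num
    linarith
  -- the geometric factor
  have hgeo : Real.sqrt θ ^ (l + 1 - m) ≤ Real.exp (-(Real.log 2 / 2) * ((b.val : ℝ) - a.val - Ru - Rv)) := by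
    have h1 : Real.sqrt θ ≤ Real.exp (-(Real.log 2 / 2)) := by
      rw [← sqrt_half_eq_exp]; exact Real.sqrt_le_sqrt hθhalf
    have h2 : Real.sqrt θ ^ (l + 1 - m) ≤ Real.exp (-(Real.log 2 / 2)) ^ (l + 1 - m) :=
      pow_le_pow_left₀ (Real.sqrt_nonneg _) h1 _
    refine h2.trans ?_
    rw [← Real.exp_nat_mul, Real.exp_le_exp]
    have hgap : (b.val : ℝ) - a.val - Ru - Rv ≤ ((l + 1 - m : ℕ) : ℝ) := gap_le_natGap haR'
    have hlog : 0 < Real.log 2 / 2 := by positivity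
    have h3 := mul_le_mul_of_nonneg_left hgap hlog.le
    linarith
  -- assemble
  rw [hcov]
  calc |S.condExp 0 (fun p => (u p - S.condExp 0 u p) * (v p - S.condExp 0 v p)) 0|
      ≤ (Real.sqrt (1 - θ))⁻¹ * Real.sqrt θ ^ (l + 1 - m) *
          Real.sqrt (S.condExp 0 (fun p => (u p - S.condExp 0 u p) ^ 2) 0) *
          Real.sqrt (S.condExp 0 (fun p => (v p - S.condExp 0 v p) ^ 2) 0) := hdecay
    _ ≤ (3 / 2) * Real.exp (-(Real.log 2 / 2) * ((b.val : ℝ) - a.val - Ru - Rv)) *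
          Real.sqrt (480 * configGradSqNorm ν u) * Real.sqrt (480 * configGradSqNorm ν v) := by
        have hsu : Real.sqrt (S.condExp 0 (fun p => (u p - S.condExp 0 u p) ^ 2) 0) ≤
            Real.sqrt (480 * configGradSqNorm ν u) := Real.sqrt_le_sqrt hVu'
        have hsv : Real.sqrt (S.condExp 0 (fun p => (v p - S.condExp 0 v p) ^ 2) 0) ≤
            Real.sqrt (480 * configGradSqNorm ν v) := Real.sqrt_le_sqrt hVv'
        refine mul_le_mul (mul_le_mul (mul_le_mul hsq1 hgeo (pow_nonneg (Real.sqrt_nonneg _) _) (by norm_num))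
          hsu (Real.sqrt_nonneg _) (mul_nonneg (by norm_num) (Real.exp_pos _).le)) hsv (Real.sqrt_nonneg _) ?_
        exact mul_nonneg (mul_nonneg (by norm_num) (Real.exp_pos _).le) (Real.sqrt_nonneg _)
    _ = (3 / 2) * 480 * Real.exp (-(Real.log 2 / 2) * ((b.val : ℝ) - a.val - Ru - Rv)) *
          Real.sqrt (configGradSqNorm ν u) * Real.sqrt (configGradSqNorm ν v) := by
        rw [Real.sqrt_mul (by norm_num), Real.sqrt_mul (by norm_num)]
        have h480 : Real.sqrt 480 * Real.sqrt 480 = 480 := Real.mul_self_sqrt (by norm_num)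
        calc (3 / 2) * Real.exp (-(Real.log 2 / 2) * ((b.val : ℝ) - a.val - Ru - Rv)) *
              (Real.sqrt 480 * Real.sqrt (configGradSqNorm ν u)) * (Real.sqrt 480 * Real.sqrt (configGradSqNorm ν v))
            = (3 / 2) * (Real.sqrt 480 * Real.sqrt 480) * Real.exp (-(Real.log 2 / 2) * ((b.val : ℝ) - a.val - Ru - Rv)) *
              Real.sqrt (configGradSqNorm ν u) * Real.sqrt (configGradSqNorm ν v) := by ring
          _ = _ := by rw [h480]
    _ = 720 * Real.exp (-(Real.log 2 / 2) * ((b.val : ℝ) - a.val - Ru - Rv)) *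
          Real.sqrt (configGradSqNorm ν u) * Real.sqrt (configGradSqNorm ν v) := by norm_num

end HeatConduction.RotorChain

open Literature.MathematicalPhysics.KineticTheory.HeatConduction HeatConduction HeatConduction.RotorChain

/-- **Discharge of `DeRoeckHuveneers2015_decorrelation_config`** — eq. (7.1) of
De Roeck–Huveneers for momentum-independent observables: for `γ ≥ 0` there are `C, c, β₁ > 0`
(here `C = 720`, `c = (log 2)/2`, `β₁ = 1/(10(2γ+2))`) such that for `0 < β < β₁`, all `N ≥ 1`
and all smooth periodic window observables `u, v` of zero mean under `ν_{N,β,γ}`,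
`|∫ uv dν| ≤ C e^{-c(|a-b| - R_u - R_v)} (∑∫(∂u)²)^{1/2} (∑∫(∂v)²)^{1/2}`. The proof is NOT the
semigroup (Helffer/Ledoux) argument cited in the source but the elementary transfer-operator /
martingale method for one-dimensional chains (`Literature/Probability/LatticeModels/WeaklyCoupledChain*.lean`):
explicit conditional expectations along the coordinate filtration, the one-step variance
recursion, the uniform Poincaré inequality and the geometric decay of increment variances.
[cite: DeRoeckHuveneers2015, §7 eq. (7.1)] -/
theorem DeRoeckHuveneers2015_decorrelation_config_holds : DeRoeckHuveneers2015_decorrelation_config := by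
  intro γ hγ
  refine ⟨720, Real.log 2 / 2, 1 / (10 * (2 * γ + 2)), by positivity, by positivity, ?_⟩
  intro β hβ hβ1 N _hN u v a b Ru Rv hus hvs _hup _hvp hu hv hu0 hv0
  have hx : β * (2 * γ + 2) ≤ 1 / 10 := by
    have h2 : 0 < 2 * γ + 2 := by positivity
    have := (lt_div_iff₀ (by positivity : (0 : ℝ) < 10 * (2 * γ + 2))).1 hβ1
    nlinarith
  have hus1 : ContDiff ℝ 1 u := hus.of_le (by norm_num)
  have hvs1 : ContDiff ℝ 1 v := hvs.of_le (by norm_num)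
  rcases le_total a b with hab | hba
  · have h := abs_integral_mul_configGibbs_le hβ hx hγ hus1 hvs1 hu hv hu0 hv0
    have e : |(a.val : ℝ) - b.val| = (b.val : ℝ) - a.val := by
      rw [abs_sub_comm, abs_of_nonneg]
      exact sub_nonneg.2 (by exact_mod_cast hab)
    rw [e]
    exact h
  · have h := abs_integral_mul_configGibbs_le hβ hx hγ hvs1 hus1 hv hu hv0 hu0
    have e : |(a.val : ℝ) - b.val| = (a.val : ℝ) - b.val :=
      abs_of_nonneg (sub_nonneg.2 (by exact_mod_cast hba))
    rw [e]
    have ecomm : ∫ q, u q * v q ∂(configGibbs N β γ) = ∫ q, v q * u q ∂(configGibbs N β γ) := by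
      congr 1; funext q; ring
    rw [ecomm]
    calc |∫ q, v q * u q ∂(configGibbs N β γ)|
        ≤ 720 * Real.exp (-(Real.log 2 / 2) * ((a.val : ℝ) - b.val - Rv - Ru)) *
            Real.sqrt (configGradSqNorm (configGibbs N β γ) v) *
            Real.sqrt (configGradSqNorm (configGibbs N β γ) u) := h
      _ = 720 * Real.exp (-(Real.log 2 / 2) * ((a.val : ℝ) - b.val - Ru - Rv)) *
            Real.sqrt (configGradSqNorm (configGibbs N β γ) u) *
            Real.sqrt (configGradSqNorm (configGibbs N β γ) v) := by
          rw [show (a.val : ℝ) - b.val - Rv - Ru = (a.val : ℝ) - b.val - Ru - Rv by ring]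
          ring

end Literature.Barriers.AtomisticToContinuum

end
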